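import Summits.QuantumFields.BalabanUV.T4Continuum.Support.VariationalCovariantAssembly

/-!
# T⁴ programme, spine node NE2 (U1a), lane P2 — SUPPLIER ITEM (O8) «V-ONE-1F», part 0: THE UPPER HALF OF THE CANONICAL-PAIR BRACKET FROM A
# ONE-STEP BOUND STATED AT CONSTRAINED MINIMISERS ONLY (abstract; a socket variant for suppliers whose one-step competitor pays regularity costs
# that are small only at minimisers — the 1-form leaf V-ONE of `VariationalVectorForm.vector_pair_bracket_sqrt`, p216339)

NE2 formalisation swarm `b2b-balaban-t4-ne2-formalise-*`, leaf prover 02 (gen 4); journal INTENT «V-ONE-1F» + located note N-ne2leaf02g4-1 (CLAIMS.log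
2026-08-20T11:15Z).  THE POINT.  The owner's brackets (`VariationalCovariantAssembly.pair_bracket`, `…AssemblySqrt.pair_bracket_sqrt`) take leaf ONE⁺ as a
bound valid for EVERY coarse field `f`, of the rigid shape `(√(Sc f + ε₁ρ f) + δ′√(qW f))²`, but USE it only at the coarse constrained minimiser `f₀`.  A
one-step competitor for the LINE-averaged 1-form constraint (tilted interpolant + second-order constraint repair) produces an extra `ε₃·√(ρ f)` inside the
square, which fits no slot of that shape for general `f` but is harmless at `f₀` (leaf REG⁺ + P⁺).  So this file states the upper half of the bracket
with the ONE-STEP HYPOTHESIS AT MINIMISERS in additive form — **`upper_half_of_min`**: `hONEmin : ∀ μ f, Qk f = μ → (f minimises Sc on the fibre) →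
blockSpin Q₁ Sf f ≤ Sc f + E·qZ μ` ⟹ `blockSpin (Qk ∘ Q₁) Sf μ ≤ blockSpin Qk Sc μ + E·qZ μ` (existence of `f₀` from UB⁺ + P⁺ by the owner's
`exists_isMinOn_fib`, then `blockSpin_comp`) — and the bookkeeping lemma **`sq_sqrt_three_le`** turning `(√(a + ε₁r) + ε₃√r + δ′√q)²` into
`a + E·z` under `a ≤ Λz`, `r ≤ C_R(a + z)`, `q ≤ C_P(Λ+1)z`.  Pure bookkeeping over the owner's kernel; nothing of any leaf is proved here.

HONEST FRAMING (T4-DAG p. 1).  [folklore] real-number bookkeeping + the tree's compactness lemma; model-agnostic; no `def`; no `sorry`; axioms standard.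
NE2 NOT proved; spine PROVED 0∕9; rung (B)+1 finite T⁴ — NOT infinite volume, NOT a mass gap, NOT Clay.  HONEST DEPENDENCY (cell, verbatim): continuum
YM on T⁴ ⇐ BetaPertH ∧ nine spine estimates (0/9 proved); BetaPertH ⇐ (D1) ∧ (D4) ∧ CAP+tail; G-an2-4 gates asym, D1 and NE2/3/4.
-/

noncomputable section

namespace Summit.QuantumFields.BalabanUV.T4Continuum.VariationalAssemblyMin

open Summit.QuantumFields.BalabanUV.T4Continuum.VariationalTransfer
open Summit.QuantumFields.BalabanUV.T4Continuum.VariationalCovariantAssembly (exists_isMinOn_fib)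

variable {V W Z : Type*} [NormedAddCommGroup W] [ProperSpace W] [TopologicalSpace Z] [T1Space Z]

/-- **THE UPPER HALF OF THE BRACKET FROM A ONE-STEP BOUND AT MINIMISERS**: coarse data `(Qk, Sc)` with leaf UB⁺ (`Λ`) and leaf P⁺ (`C_P`) (so the
coarse constrained minimiser exists), fine data `(Q₁, Sf)` with `Q₁` onto and `Sf ≥ 0`, and the ONE-STEP hypothesis in additive form AT CONSTRAINED
MINIMISERS ONLY ⟹ `Δ_{k+1}(μ) ≤ Δ_k(μ) + E·qZ μ`. [folklore] -/
theorem upper_half_of_min {Qk : W → Z} {Q₁ : V → W} {Sc : W → ℝ} {Sf : V → ℝ} {qW : W → ℝ} {qZ : Z → ℝ}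
    (hQk : Continuous Qk) (hSc : Continuous Sc) (hsurj : Function.Surjective Q₁) (hSc0 : ∀ f, 0 ≤ Sc f) (hSf0 : ∀ f', 0 ≤ Sf f')
    {κ Λ CP E : ℝ} (hκ : 0 ≤ κ) (hCP : 0 ≤ CP) (hnormW : ∀ f, ‖f‖ ^ 2 ≤ κ * qW f)
    (hUBc : ∀ μ, ∃ f, Qk f = μ ∧ Sc f ≤ Λ * qZ μ) (hPc : ∀ f, qW f ≤ CP * (Sc f + qZ (Qk f)))
    (hONEmin : ∀ μ f, Qk f = μ → (∀ g, Qk g = μ → Sc f ≤ Sc g) → blockSpin Q₁ Sf f ≤ Sc f + E * qZ μ) (μ : Z) :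
    blockSpin (Qk ∘ Q₁) Sf μ ≤ blockSpin Qk Sc μ + E * qZ μ := by
  obtain ⟨fU, hfU, -⟩ := hUBc μ
  obtain ⟨f₀, hf₀, hmin⟩ := exists_isMinOn_fib (qZ := qZ) hQk hSc hκ hCP hnormW hPc hfU
  have hval : blockSpin Qk Sc μ = Sc f₀ := blockSpin_eq_of_isMin hSc0 hf₀ hmin
  have hT0 : ∀ A₁, 0 ≤ blockSpin Q₁ Sf A₁ := fun A₁ => blockSpin_nonneg' hSf0
  rw [blockSpin_comp hsurj hSf0, hval]
  exact (blockSpin_le hT0 hf₀).trans (hONEmin μ f₀ hf₀ hmin)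

/-- **BOOKKEEPING AT A MINIMISER**: with `a ≤ Λz`, `r ≤ C_R(a + z)`, `q ≤ C_P(Λ+1)z` (`a, r, z ≥ 0`) and nonnegative `ε₁, ε₃, δ′`,
`(√(a + ε₁r) + ε₃√r + δ′√q)² ≤ a + E·z` with the explicit
`E = ε₁C_R(Λ+1) + 2(ε₃√(C_R(Λ+1)) + δ′√(C_P(Λ+1)))·√(Λ + ε₁C_R(Λ+1)) + (ε₃√(C_R(Λ+1)) + δ′√(C_P(Λ+1)))²`. [folklore] -/
theorem sq_sqrt_three_le {a r q z Λ CR CP ε₁ ε₃ δ' : ℝ} (ha : 0 ≤ a) (hr : 0 ≤ r) (hz : 0 ≤ z) (hΛ : 0 ≤ Λ) (hCR : 0 ≤ CR)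
    (hCP : 0 ≤ CP) (hε₁ : 0 ≤ ε₁) (hε₃ : 0 ≤ ε₃) (hδ' : 0 ≤ δ') (haz : a ≤ Λ * z) (hrz : r ≤ CR * (a + z)) (hqz : q ≤ CP * (Λ + 1) * z) :
    (Real.sqrt (a + ε₁ * r) + ε₃ * Real.sqrt r + δ' * Real.sqrt q) ^ 2
      ≤ a + (ε₁ * CR * (Λ + 1) + 2 * (ε₃ * Real.sqrt (CR * (Λ + 1)) + δ' * Real.sqrt (CP * (Λ + 1))) * Real.sqrt (Λ + ε₁ * CR * (Λ + 1))
          + (ε₃ * Real.sqrt (CR * (Λ + 1)) + δ' * Real.sqrt (CP * (Λ + 1))) ^ 2) * z := by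
  -- the three pieces against `z`
  have hr' : r ≤ CR * (Λ + 1) * z := hrz.trans (by nlinarith)
  have hA : a + ε₁ * r ≤ (Λ + ε₁ * CR * (Λ + 1)) * z := by nlinarith
  have hA0 : 0 ≤ a + ε₁ * r := by positivity
  set s := Real.sqrt (a + ε₁ * r) with hs
  set t := ε₃ * Real.sqrt r + δ' * Real.sqrt q with ht
  have hs0 : 0 ≤ s := Real.sqrt_nonneg _
  have ht0 : 0 ≤ t := by positivity
  have hs2 : s ^ 2 = a + ε₁ * r := Real.sq_sqrt hA0
  have hsz : s ≤ Real.sqrt (Λ + ε₁ * CR * (Λ + 1)) * Real.sqrt z := by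
    rw [← Real.sqrt_mul (by positivity)]; exact Real.sqrt_le_sqrt hA
  have htz : t ≤ (ε₃ * Real.sqrt (CR * (Λ + 1)) + δ' * Real.sqrt (CP * (Λ + 1))) * Real.sqrt z := by
    have h1 : Real.sqrt r ≤ Real.sqrt (CR * (Λ + 1)) * Real.sqrt z := by
      rw [← Real.sqrt_mul (by positivity)]; exact Real.sqrt_le_sqrt hr'
    have h2 : Real.sqrt q ≤ Real.sqrt (CP * (Λ + 1)) * Real.sqrt z := by
      rw [← Real.sqrt_mul (by positivity)]; exact Real.sqrt_le_sqrt hqz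
    calc t ≤ ε₃ * (Real.sqrt (CR * (Λ + 1)) * Real.sqrt z) + δ' * (Real.sqrt (CP * (Λ + 1)) * Real.sqrt z) :=
          add_le_add (mul_le_mul_of_nonneg_left h1 hε₃) (mul_le_mul_of_nonneg_left h2 hδ')
      _ = _ := by ring
  have hzz : Real.sqrt z * Real.sqrt z = z := Real.mul_self_sqrt hz
  set K := ε₃ * Real.sqrt (CR * (Λ + 1)) + δ' * Real.sqrt (CP * (Λ + 1)) with hK
  set M := Real.sqrt (Λ + ε₁ * CR * (Λ + 1)) with hM
  have hK0 : 0 ≤ K := by positivity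
  have hM0 : 0 ≤ M := Real.sqrt_nonneg _
  -- `(s + t)² = s² + 2st + t² ≤ (a + ε₁r) + 2·(M√z)(K√z) + (K√z)²`
  have hst : s * t ≤ (M * Real.sqrt z) * (K * Real.sqrt z) := mul_le_mul hsz htz ht0 (by positivity)
  have htt : t ^ 2 ≤ (K * Real.sqrt z) ^ 2 := pow_le_pow_left₀ ht0 htz 2
  have e0 : Real.sqrt (a + ε₁ * r) + ε₃ * Real.sqrt r + δ' * Real.sqrt q = s + t := by rw [hs, ht]; ring
  rw [e0]
  calc (s + t) ^ 2 = s ^ 2 + 2 * (s * t) + t ^ 2 := by ring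
    _ ≤ (a + ε₁ * r) + 2 * ((M * Real.sqrt z) * (K * Real.sqrt z)) + (K * Real.sqrt z) ^ 2 := by
        rw [hs2]; nlinarith [hst, htt]
    _ = a + ε₁ * r + (2 * K * M + K ^ 2) * z := by
        have e1 : (M * Real.sqrt z) * (K * Real.sqrt z) = K * M * z := by
          rw [show (M * Real.sqrt z) * (K * Real.sqrt z) = K * M * (Real.sqrt z * Real.sqrt z) by ring, hzz]
        have e2 : (K * Real.sqrt z) ^ 2 = K ^ 2 * z := by rw [mul_pow, Real.sq_sqrt hz]
        rw [e1, e2]; ring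
    _ ≤ a + ε₁ * (CR * (Λ + 1) * z) + (2 * K * M + K ^ 2) * z := by nlinarith [mul_le_mul_of_nonneg_left hr' hε₁]
    _ = _ := by simp only [hK, hM]; ring

end Summit.QuantumFields.BalabanUV.T4Continuum.VariationalAssemblyMin

end
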